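import Mathlib.AlgebraicGeometry.Modules.Sheaf
import Mathlib.AlgebraicGeometry.Restrict
import HarnessLib

/-!
# The comparison `ι_*𝒪_Z → (π ≫ ι)_*𝒪_Y` of push-forwards of structure sheaves, monomorphisms, iso loci

For morphisms of schemes `π : Y → Z` and `ι : Z → X`, the pull-back of functions `π^*` defines a
morphism of sheaves of `𝒪_X`-modules `ι_*𝒪_Z → (π ≫ ι)_*𝒪_Y` (Mathlib `Scheme.Modules.pushforward` of
`SheafOfModules.unit`): `pushforwardUnitHom π ι`, with `app W = π^* : Γ(ι⁻¹W, 𝒪_Z) → Γ(π⁻¹ι⁻¹W, 𝒪_Y)`.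
This is the map `𝒪_X → π_*𝒪_{X'}` of Görtz–Wedhorn II, proof of Thm. 23.17 ("we obtain a
homomorphism of short exact sequences `0 → 𝒪_X → π_*𝒢' → …`"), pushed forward from the closed
subscheme `Z` to the ambient `X`. We also record:

* `mono_of_app_injective` — a morphism of `𝒪_X`-modules injective on all sections is a monomorphism;
* `app_surjective_of_isIso_morphismRestrict` — if `π` is an isomorphism over the open `V ⊆ Z` then
  `π^* : Γ(U', 𝒪_Z) → Γ(π⁻¹U', 𝒪_Y)` is surjective for `U' ⊆ V`.

Everything is proved; no named facts. Mathlib searched (pin v4.32): `PresheafOfModules.homMk`,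
`Scheme.Modules.hom_ext`, `morphismRestrict_app`, `Scheme.Hom.image_preimage_eq_opensRange_inf` (used).

## References

* U. Görtz, T. Wedhorn, *Algebraic Geometry II* (2023): Thm. 23.17, proof, p. 425. [GortzWedhorn2023]
-/

noncomputable section

open CategoryTheory AlgebraicGeometry TopologicalSpace Opposite

universe u

namespace Literature.AlgebraicGeometry.Modules

variable {X Y Z : Scheme.{u}} (π : Y ⟶ Z) (ι : Z ⟶ X)

/-- The underlying morphism of abelian presheaves of `pushforwardUnitHom`: `W ↦ π^*_{ι⁻¹W}`. [folklore] -/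
def pushforwardUnitHomPresheaf :
    ((Scheme.Modules.pushforward ι).obj (SheafOfModules.unit Z.ringCatSheaf)).presheaf ⟶
      ((Scheme.Modules.pushforward (π ≫ ι)).obj (SheafOfModules.unit Y.ringCatSheaf)).presheaf where
  app W := AddCommGrpCat.ofHom (π.app (ι ⁻¹ᵁ W.unop)).hom.toAddMonoidHom
  naturality {W W'} i := by
    ext (s : Γ(Z, ι ⁻¹ᵁ W.unop))
    change (Z.presheaf.map ((Opens.map ι.base).map i.unop).op ≫ π.app (ι ⁻¹ᵁ W'.unop)) s =
      (π.app (ι ⁻¹ᵁ W.unop) ≫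
        Y.presheaf.map ((Opens.map π.base).map ((Opens.map ι.base).map i.unop).op.unop).op) s
    exact ConcreteCategory.congr_hom (π.naturality ((Opens.map ι.base).map i.unop).op) s

/-- **The comparison `ι_*𝒪_Z → (π ≫ ι)_*𝒪_Y`**, `app W = π^*`. [cite: GortzWedhorn2023, Thm. 23.17 proof (p. 425)] -/
def pushforwardUnitHom :
    (Scheme.Modules.pushforward ι).obj (SheafOfModules.unit Z.ringCatSheaf) ⟶
      (Scheme.Modules.pushforward (π ≫ ι)).obj (SheafOfModules.unit Y.ringCatSheaf) :=
  ⟨PresheafOfModules.homMk (pushforwardUnitHomPresheaf π ι) fun W r s => by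
    change π.app (ι ⁻¹ᵁ W.unop) (@HMul.hMul Γ(Z, ι ⁻¹ᵁ W.unop) Γ(Z, ι ⁻¹ᵁ W.unop) Γ(Z, ι ⁻¹ᵁ W.unop)
        instHMul (ι.app W.unop r) s) =
      @HMul.hMul Γ(Y, (π ≫ ι) ⁻¹ᵁ W.unop) Γ(Y, (π ≫ ι) ⁻¹ᵁ W.unop) Γ(Y, (π ≫ ι) ⁻¹ᵁ W.unop) instHMul
        ((π ≫ ι).app W.unop r) (π.app (ι ⁻¹ᵁ W.unop) s)
    rw [map_mul, Scheme.Hom.comp_app]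
    rfl⟩

/-- `pushforwardUnitHom` acts on sections by `π^*`. [folklore] -/
theorem pushforwardUnitHom_app_apply (W : X.Opens) (s : Γ(Z, ι ⁻¹ᵁ W)) :
    (pushforwardUnitHom π ι).app W s = π.app (ι ⁻¹ᵁ W) s := rfl

/-- A morphism of sheaves of `𝒪_X`-modules which is injective on all sections is a monomorphism.
[folklore] -/
theorem mono_of_app_injective {M N : X.Modules} (φ : M ⟶ N)
    (h : ∀ U : X.Opens, Function.Injective (φ.app U)) : Mono φ :=
  ⟨fun a b hab => Scheme.Modules.hom_ext _ _ fun U => by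
    ext t
    apply h U
    change (a ≫ φ).app U t = (b ≫ φ).app U t
    rw [hab]⟩

/-- **If `π` is an isomorphism over `V ⊆ Z`, then `π^* : Γ(U', 𝒪_Z) → Γ(π⁻¹U', 𝒪_Y)` is surjective for
every open `U' ⊆ V`.** [folklore] -/
theorem app_surjective_of_isIso_morphismRestrict (V : Z.Opens) [IsIso (π ∣_ V)] {U' : Z.Opens}
    (hU' : U' ≤ V) : Function.Surjective (π.app U') := by
  have e : V.ι ''ᵁ (V.ι ⁻¹ᵁ U') = U' := by
    rw [Scheme.Hom.image_preimage_eq_opensRange_inf, Scheme.Opens.opensRange_ι, inf_eq_right.mpr hU']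
  rw [← e]
  intro t
  obtain ⟨s, hs⟩ := (ConcreteCategory.bijective_of_isIso ((π ∣_ V).app (V.ι ⁻¹ᵁ U'))).2
    (Y.presheaf.map (eqToHom (image_morphismRestrict_preimage π V (V.ι ⁻¹ᵁ U'))).op t)
  refine ⟨s, (ConcreteCategory.bijective_of_isIso
    (Y.presheaf.map (eqToHom (image_morphismRestrict_preimage π V (V.ι ⁻¹ᵁ U'))).op)).1 ?_⟩
  rw [morphismRestrict_app] at hs
  exact hs

end Literature.AlgebraicGeometry.Modules

end
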